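import Summits.NavierStokesRegularity.NavierStokesRegularity.Theorems.PerpetualPumpAveragedTypeIBlowupPulseGate
import Summits.NavierStokesRegularity.NavierStokesRegularity.Theorems.PerpetualPumpAveragedTypeIBlowupIncubationTools

/-!
# Crux `PerpetualPump.AveragedTypeIBlowup` (stmt-NavierStokesRegularity-1835), line `Sketch`:
# tools for the stub `pulse`, III — the logistic clock of the gate and its first half

Third layer of the proof of the registered stub `stub_pulse` (the TRANSFER PULSE of the forced
Toda gate `b' = -b - w² + f₁`, `w' = w(b - β - 1) + f₂`, `β' = -q⁴β + w² + f₃`, `|fᵢ| ≤ φ ≤ 1/2000`,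
`B ≥ 10⁴`, `q⁴ ∈ [1, 1.11]`), continuing `…PulseTools.lean`, `…PulseGate.lean`. Throughout, `[0, T]`
is a GATE PHASE: `w ≥ 1` there and `B T ≤ 5 log B + 20`; `R = √((b-β)² + 2w²)`, `u = (b-β)/R`.

* `pulse_gate_clock` (= registered sub-goal `stub_pulseClock`) — the clock is a sub-solution of the
  forced logistic equation `u' ≤ -(49B/50)(1 - u²) + 1/(1000 B)` inside `[0, T]` (from the raw
  inequality of `stub_gateAlgebra`, `R ≥ 0.99 B`, `|g₁| ≤ 0.1101 B`), it never exceeds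
  `1 - 1/(202 B)` (`logisticClock_barrier`, `u(0) ≤ 1 - 1/(101 B)`), and the state satisfies
  `(P-R)/2 = J/(P+R) ∈ [-43/500, 33/2000]`, `b ≥ -43/500`, `|β| ≤ 1/50 + 0.5005 B (1-u)`,
  `|w| ≤ 0.71 B`.
* `pulse_gate_firsthalf` — at the FIRST zero `σm` of the clock, `u > 0` before, and
  `(49B/50) ∫₀^{σm} (1 - u) ≤ 1 + T/(1000 B)` (integrate `(1-u)' ≥ (49B/50)(1-u) - 1/(1000B)`).
* `pulse_gate_reach` — the clock does reach `0` within `t₁ = log (128 B)/(49B/50)` (exponential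
  growth of `1 - u - ψ/K` through its logarithm).

## References

Folklore ODE comparison arguments; the gate is the Toda-type transfer step of T. Tao, *Finite time
blowup for an averaged three-dimensional Navier–Stokes equation*, J. Amer. Math. Soc. 29 (2016),
601–674, §5.4–5.5.
-/

noncomputable section

-- the summit namespace `…NavierStokesRegularity.NavierStokesRegularity…` is the tree convention
set_option linter.dupNamespace false

open MeasureTheory Set Filter Topology

namespace Summit.NavierStokesRegularity.NavierStokesRegularity.Theorems.PerpetualPumpAveragedTypeIBlowup

/-- **The gate phase, II: the clock and `(P - R)/2`.** Under the hypotheses of `pulse_gate_radius`,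
`u` is a sub-solution of the forced logistic clock `u' ≤ -(49B/50)(1 - u²) + 1/(1000 B)` inside
`[0, T]`, never exceeds `1 - 1/(202 B)` there (`logisticClock_barrier`, `u(0) ≤ 1 - 1/(101 B)`), and
`(P - R)/2 = J/(P + R) ∈ [-43/500, 33/2000]`. [folklore] -/
theorem pulse_gate_clock (b w β f₁ f₂ f₃ R u : ℝ → ℝ) (B q4 φ σ₁ T : ℝ)
    (hB : 10 ^ 4 ≤ B) (hq1 : 1 ≤ q4) (hq2 : q4 ≤ 111 / 100) (hφ0 : 0 ≤ φ) (hφ1 : φ ≤ 1 / 2000)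
    (hσ₁ : σ₁ ≤ 1 / 10)
    (hbc : ContinuousOn b (Icc 0 σ₁)) (hwc : ContinuousOn w (Icc 0 σ₁))
    (hβc : ContinuousOn β (Icc 0 σ₁))
    (hbd : ∀ σ ∈ Ioo 0 σ₁, HasDerivAt b (-(b σ) - (w σ) ^ 2 + f₁ σ) σ)
    (hwd : ∀ σ ∈ Ioo 0 σ₁, HasDerivAt w (w σ * (b σ - β σ - 1) + f₂ σ) σ)
    (hβd : ∀ σ ∈ Ioo 0 σ₁, HasDerivAt β (-(q4 * β σ) + (w σ) ^ 2 + f₃ σ) σ)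
    (hf : ∀ σ ∈ Icc 0 σ₁, |f₁ σ| ≤ φ ∧ |f₂ σ| ≤ φ ∧ |f₃ σ| ≤ φ)
    (hb0 : b 0 = B) (hw0 : w 0 = Real.sqrt B / 10) (hβ0 : |β 0| ≤ 1 / 50)
    (hR : R = fun s => Real.sqrt ((b s - β s) ^ 2 + 2 * (w s) ^ 2))
    (hu : u = fun s => (b s - β s) / R s)
    (hT0 : 0 < T) (hT1 : T ≤ σ₁) (hTB : B * T ≤ 5 * Real.log B + 20)
    (hw1 : ∀ σ ∈ Icc 0 T, 1 ≤ w σ) :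
    (∀ σ ∈ Ioo 0 T, ∃ u' : ℝ, HasDerivAt u u' σ ∧
        u' ≤ -(49 * B / 50 * (1 - (u σ) ^ 2)) + 1 / (1000 * B)) ∧
    ∀ σ ∈ Icc 0 T, u σ ≤ 1 - 1 / (202 * B) ∧
      (-(43 / 500) ≤ (b σ + β σ - R σ) / 2 ∧ (b σ + β σ - R σ) / 2 ≤ 33 / 2000) ∧
      -(43 / 500) ≤ b σ ∧ |β σ| ≤ 1 / 50 + 1001 / 2000 * B * (1 - u σ) ∧
      |w σ| ≤ 71 / 100 * B := by
  have hB0 : 0 < B := lt_of_lt_of_le (by norm_num) hB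
  have hw0sq : w 0 ^ 2 = B / 100 := by
    rw [hw0, div_pow, Real.sq_sqrt hB0.le]; norm_num
  have hs2 : Real.sqrt 2 ≤ 3 / 2 := by
    rw [Real.sqrt_le_left (by norm_num)]; norm_num
  have henv := pulse_envelope_energy b w β f₁ f₂ f₃ B q4 φ σ₁ hB hq1 hq2 hφ0 hφ1 hσ₁ hbc hwc hβc
    hbd hwd hβd hf hb0 hw0 hβ0
  have hquad := pulse_envelope_quad b w β f₁ f₂ f₃ B q4 φ σ₁ hB hq1 hq2 hφ1 hbc hwc hβc
    hbd hwd hβd hf hb0 hw0 hβ0 (fun σ hσ => let h := henv σ hσ; ⟨h.1, h.2.1, h.2.2.1, h.2.2.2.1⟩)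
  obtain ⟨-, huc, hder, hRb⟩ := pulse_gate_radius b w β f₁ f₂ f₃ R u B q4 φ σ₁ T hB hq1 hq2 hφ0
    hφ1 hσ₁ hbc hwc hβc hbd hwd hβd hf hb0 hw0 hβ0 hR hu hT0 hT1 hTB hw1
  have hTI : Icc 0 T ⊆ Icc 0 σ₁ := Icc_subset_Icc_right hT1
  have hRs : ∀ s, Real.sqrt ((b s - β s) ^ 2 + 2 * (w s) ^ 2) = R s := fun s => by rw [hR]
  have hus : ∀ s, u s = (b s - β s) / R s := fun s => by rw [hu]
  have hpt : ∀ s ∈ Icc 0 T, 0 < R s ∧ R s ^ 2 = (b s - β s) ^ 2 + 2 * (w s) ^ 2 ∧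
      b s - β s = u s * R s ∧ -1 ≤ u s ∧ u s ≤ 1 ∧ 2 * (w s) ^ 2 = R s ^ 2 * (1 - (u s) ^ 2) ∧
      (b s + β s - R s) * (b s + β s + R s) = 2 * (2 * b s * β s - (w s) ^ 2) := fun s hs =>
    pulse_gate_point (by linarith [hw1 s hs]) (hRs s) (hus s)
  -- the clock inequality
  have hclock : ∀ σ ∈ Ioo 0 T, ∃ u' : ℝ, HasDerivAt u u' σ ∧
      u' ≤ -(49 * B / 50 * (1 - (u σ) ^ 2)) + 1 / (1000 * B) := by
    intro s hs
    obtain ⟨-, ⟨u', g, hu', hg, hub⟩⟩ := hder s hs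
    obtain ⟨hRs99, -⟩ := hRb s (Ioo_subset_Icc_self hs)
    have hRpos : 0 < R s := by linarith
    obtain ⟨-, h2, -⟩ := hf s ⟨hs.1.le, hs.2.le.trans hT1⟩
    obtain ⟨-, -, -, hu1, hu2, -⟩ := hpt s (Ioo_subset_Icc_self hs)
    refine ⟨u', hu', hub.trans ?_⟩
    have hgR : |g| / R s ≤ 1 / 5 := by
      rw [div_le_iff₀ hRpos]; linarith
    have hfR : Real.sqrt 2 * |f₂ s| / R s ≤ 1 / (1000 * B) := by
      rw [div_le_div_iff₀ hRpos (by positivity), one_mul]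
      have e2 : Real.sqrt 2 * |f₂ s| ≤ 3 / 2 * φ := mul_le_mul hs2 h2 (abs_nonneg _) (by norm_num)
      nlinarith
    have hsq : 0 ≤ 1 - u s ^ 2 := by nlinarith
    have hrate : 49 * B / 50 ≤ R s - |g| / R s := by linarith
    nlinarith [mul_le_mul_of_nonneg_right hrate hsq]
  -- the upper barrier for `u`
  have hu0 : u 0 ≤ 1 - 1 / (101 * B) := by
    obtain ⟨hR0pos, hR0sq, hD0, -⟩ := hpt 0 (left_mem_Icc.2 hT0.le)
    rw [hb0, hw0sq] at hR0sq
    rw [hb0] at hD0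
    exact (pulse_alg_u0 hB hβ0 hR0pos hR0sq hD0).2.2
  have hψ : 1 / (1000 * B) ≤ 49 * B / 50 * (1 / (101 * B)) * 1 / 4 := by
    have e : 49 * B / 50 * (1 / (101 * B)) * 1 / 4 = 49 / 20200 := by
      field_simp
      ring
    rw [e, div_le_div_iff₀ (by positivity) (by norm_num)]
    linarith
  have hubar : ∀ σ ∈ Icc 0 T, u σ ≤ 1 - 1 / (101 * B) / 2 :=
    logisticClock_barrier (R := 49 * B / 50) (ψ := 1 / (1000 * B)) (a₀ := 1 / (101 * B)) (a₁ := 1)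
      (by positivity) (by positivity)
      (by rw [div_le_one (by positivity)]; linarith) le_rfl hψ huc hclock hu0
  refine ⟨hclock, fun σ hσ => ?_⟩
  have hu202 : u σ ≤ 1 - 1 / (202 * B) := by
    have := hubar σ hσ
    have e : 1 - 1 / (101 * B) / 2 = 1 - 1 / (202 * B) := by ring
    linarith
  obtain ⟨hRpos, -, hD, hu1, hu2, hw2, hPR⟩ := hpt σ hσ
  obtain ⟨-, -, hβa, hβlo, -, hPlo⟩ := henv σ (hTI hσ)
  obtain ⟨hJhi, hLlo, -⟩ := hquad σ (hTI hσ)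
  obtain ⟨hRσ, hRhi, -⟩ := hRb σ hσ
  have hBσ : B * σ ≤ B * (1 / 10) := mul_le_mul_of_nonneg_left (hσ.2.trans (hT1.trans hσ₁)) hB0.le
  have hP : 888 / 1000 * B ≤ b σ + β σ := by linarith
  have hJlo : -(4 * B / 25 + 1 / 50) ≤ 2 * b σ * β σ - (w σ) ^ 2 := by
    have : (q4 - 1) * β σ ≤ (q4 - 1) * (B + 1 / 100) :=
      mul_le_mul_of_nonneg_left (abs_le.1 hβa).2 (by linarith)
    have e3 : q4 * B ≤ 111 / 100 * B := mul_le_mul_of_nonneg_right hq2 hB0.le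
    linarith
  have hX := pulse_alg_X hB hPR (by linarith) hJlo hJhi
  exact ⟨hu202, hX, pulse_alg_state hB hRpos hRhi hD hu1 hu2 hw2 hX.1 hX.2 hβlo⟩

/-- **The gate phase, III: first half of the clock.** If the clock `u` reaches `0` somewhere on
`[0, T]` (say at `s`), then at its FIRST zero `σm ≤ s` we have `u > 0` on `[0, σm)` and the time integral of
`1 - u` up to `σm` is `≤ (1 + T/(1000 B))/(49B/50)`: indeed `(1 - u)' ≥ (49B/50)(1 - u) - 1/(1000B)`
while `u ≥ 0`, and one integrates this inequality (`incubation_integral_le_sub`). [folklore] -/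
theorem pulse_gate_firsthalf (b w β f₁ f₂ f₃ R u : ℝ → ℝ) (B q4 φ σ₁ T : ℝ)
    (hB : 10 ^ 4 ≤ B) (hq1 : 1 ≤ q4) (hq2 : q4 ≤ 111 / 100) (hφ0 : 0 ≤ φ) (hφ1 : φ ≤ 1 / 2000)
    (hσ₁ : σ₁ ≤ 1 / 10)
    (hbc : ContinuousOn b (Icc 0 σ₁)) (hwc : ContinuousOn w (Icc 0 σ₁))
    (hβc : ContinuousOn β (Icc 0 σ₁))
    (hbd : ∀ σ ∈ Ioo 0 σ₁, HasDerivAt b (-(b σ) - (w σ) ^ 2 + f₁ σ) σ)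
    (hwd : ∀ σ ∈ Ioo 0 σ₁, HasDerivAt w (w σ * (b σ - β σ - 1) + f₂ σ) σ)
    (hβd : ∀ σ ∈ Ioo 0 σ₁, HasDerivAt β (-(q4 * β σ) + (w σ) ^ 2 + f₃ σ) σ)
    (hf : ∀ σ ∈ Icc 0 σ₁, |f₁ σ| ≤ φ ∧ |f₂ σ| ≤ φ ∧ |f₃ σ| ≤ φ)
    (hb0 : b 0 = B) (hw0 : w 0 = Real.sqrt B / 10) (hβ0 : |β 0| ≤ 1 / 50)
    (hR : R = fun s => Real.sqrt ((b s - β s) ^ 2 + 2 * (w s) ^ 2))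
    (hu : u = fun s => (b s - β s) / R s)
    (hT0 : 0 < T) (hT1 : T ≤ σ₁) (hTB : B * T ≤ 5 * Real.log B + 20)
    (hw1 : ∀ σ ∈ Icc 0 T, 1 ≤ w σ)
    {s : ℝ} (hs : s ∈ Icc 0 T) (hus0 : u s ≤ 0) :
    ∃ σm ∈ Ioc 0 s, u σm = 0 ∧ (∀ σ ∈ Ico 0 σm, 0 < u σ) ∧
      49 * B / 50 * ∫ σ in (0 : ℝ)..σm, (1 - u σ) ≤ 1 + T / (1000 * B) := by
  have hB0 : 0 < B := lt_of_lt_of_le (by norm_num) hB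
  obtain ⟨-, huc, -, -⟩ := pulse_gate_radius b w β f₁ f₂ f₃ R u B q4 φ σ₁ T hB hq1 hq2 hφ0 hφ1 hσ₁ hbc hwc hβc hbd hwd hβd hf hb0 hw0 hβ0 hR hu hT0 hT1 hTB hw1
  obtain ⟨hclock, -⟩ := pulse_gate_clock b w β f₁ f₂ f₃ R u B q4 φ σ₁ T hB hq1 hq2 hφ0 hφ1 hσ₁ hbc hwc hβc hbd hwd hβd hf hb0 hw0 hβ0 hR hu hT0 hT1 hTB hw1
  have hRs : ∀ s, Real.sqrt ((b s - β s) ^ 2 + 2 * (w s) ^ 2) = R s := fun s => by rw [hR]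
  have hus : ∀ s, u s = (b s - β s) / R s := fun s => by rw [hu]
  -- `u 0 > 0`
  obtain ⟨hu0, hu01⟩ : 0 < u 0 ∧ u 0 ≤ 1 := by
    obtain ⟨hR0pos, -, -, -, hu01, -⟩ :=
      pulse_gate_point (by linarith [hw1 0 (left_mem_Icc.2 hT0.le)]) (hRs 0) (hus 0)
    refine ⟨?_, hu01⟩
    rw [hus 0, hb0]
    exact div_pos (by linarith [(abs_le.1 hβ0).2]) hR0pos
  -- the first zero of `u` on `[0, s]`
  obtain ⟨σm, hσm, hum, hbefore⟩ := ivtNesting_exists_first_eq (f := fun t => -u t) (y := 0) hs.1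
    (huc.mono (Icc_subset_Icc_right hs.2)).neg (show -u 0 ≤ 0 by linarith)
    (show 0 ≤ -u s by linarith)
  have hum0 : u σm = 0 := by
    have h : -u σm = 0 := hum
    linarith
  have hpos : ∀ σ ∈ Ico 0 σm, 0 < u σ := fun σ hσ => by
    have h : -u σ < 0 := hbefore σ hσ
    linarith
  have hσm0 : 0 < σm := by
    rcases hσm.1.eq_or_lt with h | h
    · rw [← h] at hum0; linarith
    · exact h
  have hσmT : σm ≤ T := hσm.2.trans hs.2
  refine ⟨σm, ⟨hσm0, hσm.2⟩, hum0, hpos, ?_⟩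
  -- integrate `(1 - u)' ≥ K (1 - u) - ψ` on `[0, σm]`
  have hzc : ContinuousOn (fun t => 1 - u t) (Icc 0 σm) :=
    (continuousOn_const.sub huc).mono (Icc_subset_Icc_right hσmT)
  have hφc : ContinuousOn (fun t => 49 * B / 50 * (1 - u t) - 1 / (1000 * B)) (Icc 0 σm) :=
    (hzc.const_mul (49 * B / 50)).sub continuousOn_const
  have key := incubation_integral_le_sub hσm0.le hzc hφc (fun x hx => by
      obtain ⟨u', hu', hle⟩ := hclock x ⟨hx.1, hx.2.trans_le hσmT⟩
      refine ⟨-u', hu'.const_sub 1, ?_⟩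
      have hux : 0 ≤ u x := (hpos x ⟨hx.1.le, hx.2⟩).le
      obtain ⟨-, -, -, -, hu2, -⟩ := pulse_gate_point (by linarith [hw1 x ⟨hx.1.le, hx.2.le.trans hσmT⟩])
        (hRs x) (hus x)
      have : 49 * B / 50 * (1 - u x) ≤ 49 * B / 50 * (1 - u x ^ 2) := by
        apply mul_le_mul_of_nonneg_left _ (by positivity)
        nlinarith
      linarith)
  rw [intervalIntegral.integral_sub ((hzc.const_mul _).intervalIntegrable_of_Icc hσm0.le)
    (continuousOn_const.intervalIntegrable_of_Icc hσm0.le), intervalIntegral.integral_const_mul,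
    intervalIntegral.integral_const, smul_eq_mul, hum0] at key
  simp only [sub_zero] at key
  have h1 : σm * (1 / (1000 * B)) ≤ T / (1000 * B) := by
    rw [mul_one_div, div_le_div_iff_of_pos_right (by positivity)]; exact hσmT
  linarith

/-- **The gate phase, IV: the clock does reach `0`.** If the budget `t₁ = log (128 B)/(49B/50)` fits
in `[0, T]`, then `u ≤ 0` somewhere on `[0, t₁]`: otherwise `y = 1 - u - ψ/K > 0` grows at least like
`e^{K t}` (`pulse_log_growth`, `y' ≥ K y` from the clock inequality while `u > 0`), and
`y(0) ≥ 1/(128 B)` would give `y(t₁) ≥ 1`, i.e. `u(t₁) < 0`. [folklore] -/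
theorem pulse_gate_reach (b w β f₁ f₂ f₃ R u : ℝ → ℝ) (B q4 φ σ₁ T : ℝ)
    (hB : 10 ^ 4 ≤ B) (hq1 : 1 ≤ q4) (hq2 : q4 ≤ 111 / 100) (hφ0 : 0 ≤ φ) (hφ1 : φ ≤ 1 / 2000)
    (hσ₁ : σ₁ ≤ 1 / 10)
    (hbc : ContinuousOn b (Icc 0 σ₁)) (hwc : ContinuousOn w (Icc 0 σ₁))
    (hβc : ContinuousOn β (Icc 0 σ₁))
    (hbd : ∀ σ ∈ Ioo 0 σ₁, HasDerivAt b (-(b σ) - (w σ) ^ 2 + f₁ σ) σ)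
    (hwd : ∀ σ ∈ Ioo 0 σ₁, HasDerivAt w (w σ * (b σ - β σ - 1) + f₂ σ) σ)
    (hβd : ∀ σ ∈ Ioo 0 σ₁, HasDerivAt β (-(q4 * β σ) + (w σ) ^ 2 + f₃ σ) σ)
    (hf : ∀ σ ∈ Icc 0 σ₁, |f₁ σ| ≤ φ ∧ |f₂ σ| ≤ φ ∧ |f₃ σ| ≤ φ)
    (hb0 : b 0 = B) (hw0 : w 0 = Real.sqrt B / 10) (hβ0 : |β 0| ≤ 1 / 50)
    (hR : R = fun s => Real.sqrt ((b s - β s) ^ 2 + 2 * (w s) ^ 2))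
    (hu : u = fun s => (b s - β s) / R s)
    (hT0 : 0 < T) (hT1 : T ≤ σ₁) (hTB : B * T ≤ 5 * Real.log B + 20)
    (hw1 : ∀ σ ∈ Icc 0 T, 1 ≤ w σ)
    (ht₁ : Real.log (128 * B) / (49 * B / 50) ≤ T) :
    ∃ s ∈ Icc 0 (Real.log (128 * B) / (49 * B / 50)), u s ≤ 0 := by
  have hB0 : 0 < B := lt_of_lt_of_le (by norm_num) hB
  obtain ⟨-, huc, -, -⟩ := pulse_gate_radius b w β f₁ f₂ f₃ R u B q4 φ σ₁ T hB hq1 hq2 hφ0 hφ1 hσ₁ hbc hwc hβc hbd hwd hβd hf hb0 hw0 hβ0 hR hu hT0 hT1 hTB hw1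
  obtain ⟨hclock, hcl⟩ := pulse_gate_clock b w β f₁ f₂ f₃ R u B q4 φ σ₁ T hB hq1 hq2 hφ0 hφ1 hσ₁ hbc hwc hβc hbd hwd hβd hf hb0 hw0 hβ0 hR hu hT0 hT1 hTB hw1
  have hRs : ∀ s, Real.sqrt ((b s - β s) ^ 2 + 2 * (w s) ^ 2) = R s := fun s => by rw [hR]
  have hus : ∀ s, u s = (b s - β s) / R s := fun s => by rw [hu]
  have hK0 : (0 : ℝ) < 49 * B / 50 := by positivity
  have ht₁0 : 0 ≤ Real.log (128 * B) / (49 * B / 50) :=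
    div_nonneg (Real.log_nonneg (by linarith)) hK0.le
  have hψK : 1 / (1000 * B) / (49 * B / 50) ≤ 1 / (10000 * B) := by
    rw [div_div, one_div_le_one_div (by positivity) (by positivity)]
    nlinarith
  have hψK0 : 0 < 1 / (1000 * B) / (49 * B / 50) := by positivity
  by_contra! hcon
  -- `y = 1 - u - ψ/K > 0` on `[0, t₁]`
  have hy : ∀ s ∈ Icc 0 (Real.log (128 * B) / (49 * B / 50)),
      0 < 1 - u s - 1 / (1000 * B) / (49 * B / 50) := by
    intro s hs
    obtain ⟨hub, -⟩ := hcl s ⟨hs.1, hs.2.trans ht₁⟩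
    have : 1 / (10000 * B) < 1 / (202 * B) := by
      apply one_div_lt_one_div_of_lt (by positivity); linarith
    linarith
  have hyc : ContinuousOn (fun s => 1 - u s - 1 / (1000 * B) / (49 * B / 50))
      (Icc 0 (Real.log (128 * B) / (49 * B / 50))) :=
    ((continuousOn_const.sub huc).sub continuousOn_const).mono (Icc_subset_Icc_right ht₁)
  have hgrow := pulse_log_growth (K := 49 * B / 50) ht₁0 hy hyc (fun s hs => by
      obtain ⟨u', hu', hle⟩ := hclock s ⟨hs.1, hs.2.trans_le ht₁⟩
      refine ⟨-u', (hu'.const_sub 1).sub_const _, ?_⟩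
      have hus0 : 0 < u s := hcon s (Ioo_subset_Icc_self hs)
      obtain ⟨-, -, -, -, hu2, -⟩ := pulse_gate_point
        (by linarith [hw1 s ⟨hs.1.le, hs.2.le.trans ht₁⟩]) (hRs s) (hus s)
      have h1 : 49 * B / 50 * (1 - u s) ≤ 49 * B / 50 * (1 - u s ^ 2) := by
        apply mul_le_mul_of_nonneg_left _ hK0.le
        nlinarith
      have h2 : 49 * B / 50 * (1 - u s - 1 / (1000 * B) / (49 * B / 50)) =
          49 * B / 50 * (1 - u s) - 1 / (1000 * B) := by
        field_simp
      rw [h2]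
      linarith)
  -- `y 0 ≥ 1/(128 B)`, so `log y(t₁) ≥ 0`, `y(t₁) ≥ 1`, `u(t₁) < 0`
  have hu0 : u 0 ≤ 1 - 1 / (101 * B) := by
    obtain ⟨hR0pos, hR0sq, hD0, -⟩ := pulse_gate_point (by linarith [hw1 0 (left_mem_Icc.2 hT0.le)])
      (hRs 0) (hus 0)
    have hw0sq : w 0 ^ 2 = B / 100 := by rw [hw0, div_pow, Real.sq_sqrt hB0.le]; norm_num
    rw [hb0, hw0sq] at hR0sq
    rw [hb0] at hD0
    exact (pulse_alg_u0 hB hβ0 hR0pos hR0sq hD0).2.2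
  have hy0 : 1 / (128 * B) ≤ 1 - u 0 - 1 / (1000 * B) / (49 * B / 50) := by
    have e1 : 1 / (128 * B) ≤ 1 / (101 * B) - 1 / (10000 * B) := by
      rw [div_sub_div _ _ (by positivity) (by positivity),
        div_le_div_iff₀ (by positivity) (by positivity)]
      nlinarith
    linarith
  have hlog0 : -Real.log (128 * B) ≤ Real.log (1 - u 0 - 1 / (1000 * B) / (49 * B / 50)) := by
    rw [← Real.log_inv, ← one_div]
    exact Real.log_le_log (by positivity) hy0
  have hKt : 49 * B / 50 * (Real.log (128 * B) / (49 * B / 50) - 0) = Real.log (128 * B) := by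
    rw [sub_zero, mul_div_cancel₀ _ hK0.ne']
  rw [hKt] at hgrow
  have hy1 : 1 ≤ 1 - u (Real.log (128 * B) / (49 * B / 50)) - 1 / (1000 * B) / (49 * B / 50) := by
    rw [← Real.log_nonneg_iff (hy _ (right_mem_Icc.2 ht₁0))]
    linarith
  linarith [hcon _ (right_mem_Icc.2 ht₁0)]

/-- **Registered sub-goal `stub_pulseClock` of the stub `pulse`** (closed form of
`pulse_gate_clock`): in a gate phase the clock `u = (b-β)/R` is a sub-solution of
`u' ≤ -(49B/50)(1 - u²) + 1/(1000 B)` below the barrier `1 - 1/(202 B)`, and the state satisfies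
`(P-R)/2 ∈ [-43/500, 33/2000]`, `b ≥ -43/500`, `|β| ≤ 1/50 + 0.5005 B (1-u)`, `|w| ≤ 0.71 B`.
[folklore] -/
theorem stub_pulseClock :
    ∀ (b w β f₁ f₂ f₃ R u : ℝ → ℝ) (B q4 φ σ₁ T : ℝ),
      10 ^ 4 ≤ B → 1 ≤ q4 → q4 ≤ 111 / 100 → 0 ≤ φ → φ ≤ 1 / 2000 → σ₁ ≤ 1 / 10 →
      ContinuousOn b (Icc 0 σ₁) → ContinuousOn w (Icc 0 σ₁) → ContinuousOn β (Icc 0 σ₁) →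
      (∀ σ ∈ Ioo 0 σ₁, HasDerivAt b (-(b σ) - (w σ) ^ 2 + f₁ σ) σ) →
      (∀ σ ∈ Ioo 0 σ₁, HasDerivAt w (w σ * (b σ - β σ - 1) + f₂ σ) σ) →
      (∀ σ ∈ Ioo 0 σ₁, HasDerivAt β (-(q4 * β σ) + (w σ) ^ 2 + f₃ σ) σ) →
      (∀ σ ∈ Icc 0 σ₁, |f₁ σ| ≤ φ ∧ |f₂ σ| ≤ φ ∧ |f₃ σ| ≤ φ) → b 0 = B → w 0 = Real.sqrt B / 10 →
      |β 0| ≤ 1 / 50 → (R = fun s => Real.sqrt ((b s - β s) ^ 2 + 2 * (w s) ^ 2)) →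
      (u = fun s => (b s - β s) / R s) → 0 < T → T ≤ σ₁ → B * T ≤ 5 * Real.log B + 20 →
      (∀ σ ∈ Icc 0 T, 1 ≤ w σ) →
      (∀ σ ∈ Ioo 0 T, ∃ u' : ℝ, HasDerivAt u u' σ ∧
          u' ≤ -(49 * B / 50 * (1 - (u σ) ^ 2)) + 1 / (1000 * B)) ∧
      ∀ σ ∈ Icc 0 T, u σ ≤ 1 - 1 / (202 * B) ∧
        (-(43 / 500) ≤ (b σ + β σ - R σ) / 2 ∧ (b σ + β σ - R σ) / 2 ≤ 33 / 2000) ∧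
        -(43 / 500) ≤ b σ ∧ |β σ| ≤ 1 / 50 + 1001 / 2000 * B * (1 - u σ) ∧
        |w σ| ≤ 71 / 100 * B  :=
  fun b w β f₁ f₂ f₃ R u B q4 φ σ₁ T hB hq1 hq2 hφ0 hφ1 hσ₁ hbc hwc hβc hbd hwd hβd hf hb0 hw0 hβ0
      hR hu hT0 hT1 hTB hw1 =>
    pulse_gate_clock b w β f₁ f₂ f₃ R u B q4 φ σ₁ T hB hq1 hq2 hφ0 hφ1 hσ₁ hbc hwc hβc hbd hwd hβd
      hf hb0 hw0 hβ0 hR hu hT0 hT1 hTB hw1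

end Summit.NavierStokesRegularity.NavierStokesRegularity.Theorems.PerpetualPumpAveragedTypeIBlowup

end
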